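import Literature.Probability.LatticeModels.BattleFederbushExpansion
import Literature.Probability.LatticeModels.UrsellInversion
import Mathlib.LinearAlgebra.Matrix.Determinant.Basic
import Mathlib.LinearAlgebra.Matrix.Block
import Mathlib.Data.Fintype.Sort
import Mathlib.RingTheory.MatrixAlgebra
import HarnessLib

/-!
# The Battle–Brydges–Federbush / Gawedzki–Kupiainen–Lesniewski tree expansion of truncated
fermionic expectations (determinant level)

Topic `Literature/MathematicalPhysics/QuantumLattice`; the first half of the "well known" formula
(2.66) of Benfatto–Giuliani–Mastropietro 2006 (= Mastropietro 2008, (2.118); Lesniewski 1987;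
Gentile–Mastropietro 2001), namely the **tree expansion with interpolated determinants** of the
truncated expectations of products of field monomials with respect to a fermionic Gaussian
integration, at the level of determinants.

## Setting (paired normal form of balanced monomials)

Fix a finite set `ι` of clusters and a finite linearly ordered set `F` of *field pairs*
`f = (ψ̄_f, ψ_f)`, each attached to a cluster `c f : ι` (every monomial `ψ̃(P_x)` with as many `ψ̄`
as `ψ` — e.g. the quartic interaction, or any `U(1)`-invariant kernel — can be written this way by
pairing its fields), and the *propagator matrix* `G : Matrix F F R`, `G f f' = ⟨ψ̄_f ψ_{f'}⟩`.  By
the fermionic Wick rule (`GrassmannGaussianMoments.lean`) the simple expectation of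
`∏_{x ∈ Q} ψ̃(P_x)` is, up to the global orientation sign, the **moment**
`moment c G Q = det (G restricted to the field pairs of the clusters in Q)` (increasing
enumeration `enum c Q`; Mastropietro 2008, (2.79): `𝓔(ψ̃(P₁)⋯ψ̃(P_s)) = det G`).  The **truncated
expectation** is its Ursell function `ursellOf (moment c G)` (`UrsellInversion.lean`; Mastropietro
(2.100) — no permutation signs arise for balanced monomials).

## Main results (namespace `Literature.MathematicalPhysics.QuantumLattice.FermionicTree`)

* `derivation_det` — a derivation differentiates a determinant row by row (Jacobi);
* `tmpl c G e I jm` — the **interpolated propagator matrix with replaced rows**: entry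
  `s_{{c eᵢ, c eⱼ}} · G eᵢ eⱼ` (pair variable times propagator), except that the rows of the fields
  in `I` are the unit rows `δ_{eⱼ, jm eᵢ}` (the rows already used by tree lines);
  `pderiv_det_tmpl` — `∂_{s_ℓ} det = Σ_{lines (f,f') of type ℓ} G_{ff'} · det (row f ↦ e_{f'})`;
  `assignSum` and `listDeriv_det_tmpl` — iterating along the lines of a script gives the sum over
  **anchored field-line assignments** of `∏ G_ℓ · det (rows replaced)` (Mastropietro (2.110)–(2.113));
* `det_map_aeval_tmpl_eq` — at the decoupled interpolation point `σ_s` of a script with point set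
  `Q ⊆ W` the `W`-determinant **factorises**: `det_W(σ_s) = det_Q(σ_s) · moment (W ∖ Q)` (the pairs
  crossing `∂Q` vanish, those outside `Q` are `1`; block determinant);
* `scriptTerm`, `treeSum c G v Q` (`K_v(Q)`: sum over the valid scripts rooted at `v` with point
  set `Q`, and over the field-line assignments along their lines, of
  `∏ G_ℓ ∫_{[0,1]^ι} w_s(t) det G^T(σ_s(t)) dt`) and the **peeling recursion**
  `moment_eq_sum_treeSum`: `moment W = Σ_{v ∈ Q ⊆ W} K_v(Q) · moment (W ∖ Q)`;
* `ursellOf_moment_eq_treeSum` — **the tree expansion of the truncated expectation**: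
  `𝓔ᵀ(W) = ursellOf (moment c G) W = K_v(W)` for every `v ∈ W` (Mastropietro 2008, (2.101)/(2.118):
  `𝓔ᵀ(ψ̃(P₁),…,ψ̃(P_s)) = Σ_T ∏_{ℓ∈T} g_ℓ ∫ dP_T(t) det G^T(t)`, here with the `t`-integral written as
  the sum over the scripts compatible with the anchored tree of the formal cube integrals, the
  probability measure `dP_T` and its Gram interpretation being the subject of the companion file).

Everything is proved; no named fact is introduced.

## Sources

V. Mastropietro, *Non-Perturbative Renormalization* (World Scientific, 2008), §2.8–2.9,
(2.79)–(2.119), PDF pp. 44–49 of the held copy (bib key `Mastropietro2008`); G. Benfatto,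
A. Giuliani, V. Mastropietro, Ann. Henri Poincaré 7 (2006) 809–898, (2.66)–(2.67a) (bib key
`BenfattoGiulianiMastropietro2006`); G. A. Battle, P. Federbush, Lett. Math. Phys. 8 (1984) 55–57
(`BattleFederbush1984`); D. C. Brydges, Les Houches 1984 (`Brydges1986`).  The book works with the
Grassmann representation `det G = ∫𝒟η e^{-Σ η⁺Gη⁻}` (2.80) and differentiates the exponential; here
the same interpolation is applied directly to the determinant (a polynomial in the pair variables),
`∂_{s_ℓ}` acting by Jacobi's formula, which is the determinant-level transcription of (2.85)–(2.113).
-/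

noncomputable section

open MvPolynomial Finsupp Matrix Literature.RingTheory.MvPolynomial
open Literature.Probability.LatticeModels Literature.Probability.LatticeModels.BattleFederbush

namespace Literature.MathematicalPhysics.QuantumLattice

namespace FermionicTree

/-! ### Derivations and determinants -/

section Derivation

variable {R : Type*} [CommRing R] {S : Type*} [CommRing S] [Algebra R S]

/-- Leibniz rule for a finite product: `D (∏ f) = Σ_a (∏_{b ≠ a} f b) · D (f a)`. [folklore] -/
theorem derivation_finset_prod (D : Derivation R S S) {α : Type*} [DecidableEq α] (t : Finset α)
    (f : α → S) : D (∏ a ∈ t, f a) = ∑ a ∈ t, (∏ b ∈ t.erase a, f b) * D (f a) := by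
  induction t using Finset.induction_on with
  | empty => simp
  | insert a t ha ih =>
    rw [Finset.prod_insert ha, Derivation.leibniz, smul_eq_mul, smul_eq_mul, ih, Finset.sum_insert ha,
      Finset.erase_insert ha, Finset.mul_sum, add_comm]
    congr 1
    refine Finset.sum_congr rfl fun b hb => ?_
    have hab : a ≠ b := fun h => ha (h ▸ hb)
    rw [Finset.erase_insert_of_ne hab, Finset.prod_insert (fun h => ha (Finset.mem_of_mem_erase h)),
      mul_assoc]

/-- **A derivation differentiates a determinant row by row** (Jacobi's formula, derivation
form): `D (det M) = Σᵢ det (M with row i replaced by D(row i))`. [folklore] -/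
theorem derivation_det (D : Derivation R S S) {n : Type*} [Fintype n] [DecidableEq n]
    (M : Matrix n n S) : D M.det = ∑ i, (M.updateRow i fun j => D (M i j)).det := by
  have key : ∀ N : Matrix n n S, N.det = ∑ σ : Equiv.Perm n, Equiv.Perm.sign σ • ∏ i, N i (σ i) := by
    intro N
    rw [← det_transpose, det_apply]
    rfl
  rw [key, map_sum]
  simp_rw [key]
  rw [Finset.sum_comm]
  refine Finset.sum_congr rfl fun σ _ => ?_
  rw [Units.smul_def, map_zsmul, derivation_finset_prod, Finset.smul_sum]
  refine Finset.sum_congr rfl fun i _ => ?_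
  rw [Units.smul_def]
  congr 1
  rw [← Finset.prod_erase_mul Finset.univ (fun j => M.updateRow i (fun j => D (M i j)) j (σ j))
    (Finset.mem_univ i), updateRow_self]
  congr 1
  exact Finset.prod_congr rfl fun j hj => by rw [updateRow_ne (Finset.ne_of_mem_erase hj)]

/-- Linearity of the determinant in one row, finite-sum form. [folklore] -/
theorem det_updateRow_finset_sum {n : Type*} [Fintype n] [DecidableEq n] (M : Matrix n n S) (i : n)
    {α : Type*} (t : Finset α) (g : α → n → S) :
    (M.updateRow i (∑ a ∈ t, g a)).det = ∑ a ∈ t, (M.updateRow i (g a)).det := by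
  classical
  induction t using Finset.induction_on with
  | empty =>
    rw [Finset.sum_empty, Finset.sum_empty]
    exact det_eq_zero_of_row_eq_zero i fun j => by simp
  | insert a t ha ih => rw [Finset.sum_insert ha, Finset.sum_insert ha, det_updateRow_add, ih]

/-- **Block determinant**: if, after a reindexing `Φ : m ⊕ n ≃ p`, the off-diagonal blocks of `N`
vanish, then `det N` is the product of the determinants of the diagonal blocks. [folklore] -/
theorem det_eq_mul_of_blocks {m n p : Type*} [Fintype m] [Fintype n] [Fintype p] [DecidableEq m]
    [DecidableEq n] [DecidableEq p] (N : Matrix p p S) (Φ : m ⊕ n ≃ p)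
    (h12 : ∀ x y, N (Φ (Sum.inl x)) (Φ (Sum.inr y)) = 0)
    (h21 : ∀ x y, N (Φ (Sum.inr x)) (Φ (Sum.inl y)) = 0) :
    N.det = (N.submatrix (Φ ∘ Sum.inl) (Φ ∘ Sum.inl)).det *
      (N.submatrix (Φ ∘ Sum.inr) (Φ ∘ Sum.inr)).det := by
  rw [← det_submatrix_equiv_self Φ N]
  have h : N.submatrix Φ Φ = fromBlocks (N.submatrix (Φ ∘ Sum.inl) (Φ ∘ Sum.inl)) 0 0
      (N.submatrix (Φ ∘ Sum.inr) (Φ ∘ Sum.inr)) := by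
    ext (x | x) (y | y) <;> simp [h12, h21]
  rw [h, det_fromBlocks_zero₂₁]

end Derivation

/-! ### The interpolated propagator matrix and its line derivatives -/

section Template

variable {ι : Type*} [DecidableEq ι] {F : Type*} [DecidableEq F] {R : Type*} [CommRing R]
variable (c : F → ι) (G : Matrix F F R)

/-- The **interpolated propagator matrix with replaced rows** on the fields `e₀, …, e_{r-1}`:
entry `(i, j)` is the pair variable `s_{{c eᵢ, c eⱼ}}` times the propagator `G eᵢ eⱼ`
(Mastropietro 2008, (2.81)–(2.83) and (2.114): `G^T_{(j,i),(j',i')} = t ⋯ g(x_{ji} - x_{j'i'})`),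
except that for `eᵢ ∈ I` the row is the unit row `δ_{eⱼ, jm eᵢ}` (the row of a field already used
by a tree line `(eᵢ, jm eᵢ)`). [folklore] -/
def tmpl {r : ℕ} (e : Fin r → F) (I : Finset F) (jm : F → F) :
    Matrix (Fin r) (Fin r) (MvPolynomial (Sym2 ι) R) :=
  fun i j => if e i ∈ I then (if e j = jm (e i) then 1 else 0)
    else X s(c (e i), c (e j)) * C (G (e i) (e j))

omit [DecidableEq ι] in
/-- At `s ≡ 1` and without replaced rows the interpolated matrix is the propagator matrix.
[folklore] -/
theorem eval_one_det_tmpl {r : ℕ} (e : Fin r → F) (jm : F → F) :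
    eval (fun _ => (1 : R)) (tmpl c G e ∅ jm).det = (G.submatrix e e).det := by
  rw [RingHom.map_det]
  congr 1
  ext i j
  simp [tmpl]

omit [DecidableEq ι] in
/-- Replacing one more row by a unit row. [folklore] -/
theorem updateRow_tmpl {r : ℕ} {e : Fin r → F} (he : Function.Injective e) (I : Finset F) (jm : F → F)
    (i j : Fin r) :
    (tmpl c G e I jm).updateRow i (Pi.single j 1) =
      tmpl c G e (insert (e i) I) (Function.update jm (e i) (e j)) := by
  ext i' j'
  by_cases hi : i' = i
  · subst hi
    simp only [updateRow_self, tmpl, Finset.mem_insert, true_or, if_true, Function.update_self,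
      he.eq_iff, Pi.single_apply]
  · have hne : e i' ≠ e i := he.ne hi
    simp only [updateRow_ne hi, tmpl, Finset.mem_insert, hne, false_or, Function.update_of_ne hne]

/-- **The derivative of the interpolated determinant in a pair variable** is the sum over the
field lines `(eᵢ, eⱼ)` of that cluster type, with `eᵢ` not yet used, of the propagator times the
determinant with row `i` replaced by the unit row `e_j` (Jacobi's formula; Mastropietro 2008,
(2.85): `∂_t e^{-W} = -Σ_{ℓ ∼ ∂X} V_ℓ e^{-W}`). [folklore] -/
theorem pderiv_det_tmpl {r : ℕ} {e : Fin r → F} (he : Function.Injective e) (I : Finset F)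
    (jm : F → F) (ℓ : Sym2 ι) :
    pderiv ℓ (tmpl c G e I jm).det = ∑ i, ∑ j,
      if e i ∉ I ∧ s(c (e i), c (e j)) = ℓ then
        C (G (e i) (e j)) * (tmpl c G e (insert (e i) I) (Function.update jm (e i) (e j))).det
      else 0 := by
  rw [derivation_det]
  refine Finset.sum_congr rfl fun i _ => ?_
  by_cases hi : e i ∈ I
  · have h0 : (fun j => pderiv ℓ (tmpl c G e I jm i j)) = 0 := by
      funext j
      simp only [tmpl, if_pos hi, Pi.zero_apply]
      split_ifs <;> simp
    rw [h0]
    rw [show ((tmpl c G e I jm).updateRow i 0).det = 0 from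
      det_eq_zero_of_row_eq_zero i fun j => by simp]
    refine (Finset.sum_eq_zero fun j _ => ?_).symm
    rw [if_neg (fun h => h.1 hi)]
  · set w : Fin r → MvPolynomial (Sym2 ι) R := fun j => pderiv ℓ (tmpl c G e I jm i j) with hw
    have hwj : ∀ j, w j = if s(c (e i), c (e j)) = ℓ then C (G (e i) (e j)) else 0 := by
      intro j
      simp only [hw, tmpl, if_neg hi, Derivation.leibniz, pderiv_C, zero_add, pderiv_X,
        smul_eq_mul, Pi.single_apply, mul_ite, mul_one, mul_zero]
    rw [(Finset.univ_sum_single w).symm, det_updateRow_finset_sum]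
    refine Finset.sum_congr rfl fun j _ => ?_
    rw [show Pi.single j (w j) = w j • (Pi.single j 1 : Fin r → MvPolynomial (Sym2 ι) R) by
        rw [← Pi.single_smul, smul_eq_mul, mul_one], det_updateRow_smul, updateRow_tmpl c G he, hwj]
    simp only [hi, not_false_eq_true, true_and, ite_mul, zero_mul]

/-- The **sum over field-line assignments** along a list of cluster lines `[ℓ₁, …, ℓ_k]`: at each
step a field line `(eᵢ, eⱼ)` of the cluster type `ℓ_t` with a fresh row field `eᵢ` is chosen, its
propagator `G eᵢ eⱼ` extracted and its row replaced by the unit row `e_j`; at the end the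
determinant of the remaining interpolated matrix (Mastropietro 2008, (2.110)–(2.113):
`∏_{ℓ∈T} g_ℓ ∫𝒟η₂ e^{-V₂(t)} = ∏ g_ℓ det G^T(t)`). [folklore] -/
def assignSum {r : ℕ} (e : Fin r → F) :
    List (Sym2 ι) → Finset F → (F → F) → MvPolynomial (Sym2 ι) R
  | [], I, jm => (tmpl c G e I jm).det
  | ℓ :: L, I, jm => ∑ i, ∑ j,
      if e i ∉ I ∧ s(c (e i), c (e j)) = ℓ then
        C (G (e i) (e j)) * assignSum e L (insert (e i) I) (Function.update jm (e i) (e j))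
      else 0

/-- **Iterated line derivatives of the interpolated determinant** = the sum over field-line
assignments. [folklore] -/
theorem listDeriv_det_tmpl {r : ℕ} {e : Fin r → F} (he : Function.Injective e) :
    ∀ (L : List (Sym2 ι)) (I : Finset F) (jm : F → F),
      listDeriv L (tmpl c G e I jm).det = assignSum c G e L I jm
  | [], _, _ => rfl
  | ℓ :: L, I, jm => by
    rw [listDeriv_cons, pderiv_det_tmpl c G he, assignSum, listDeriv_sum]
    refine Finset.sum_congr rfl fun i _ => ?_
    rw [listDeriv_sum]
    refine Finset.sum_congr rfl fun j _ => ?_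
    split_ifs with h
    · rw [listDeriv_C_mul, listDeriv_det_tmpl he L]
    · exact listDeriv_zero L

/-- If some line has an endpoint which is not the cluster of any of the fields `e₀, …, e_{r-1}`,
the assignment sum vanishes (no field line of that type). [folklore] -/
theorem assignSum_eq_zero_of_mem {r : ℕ} (e : Fin r → F) {z : ι} (hz : ∀ i, c (e i) ≠ z) :
    ∀ (L : List (Sym2 ι)) (_ : ∃ ℓ ∈ L, z ∈ ℓ) (I : Finset F) (jm : F → F), assignSum c G e L I jm = 0
  | [], h, _, _ => by simp at h
  | ℓ :: L, h, I, jm => by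
    rw [assignSum]
    refine Finset.sum_eq_zero fun i _ => Finset.sum_eq_zero fun j _ => ?_
    by_cases hℓ : z ∈ ℓ
    · rw [if_neg]
      rintro ⟨-, rfl⟩
      rcases Sym2.mem_iff.1 hℓ with h1 | h1
      · exact hz i h1.symm
      · exact hz j h1.symm
    · have h' : ∃ ℓ' ∈ L, z ∈ ℓ' := by
        obtain ⟨ℓ', hℓ', hz'⟩ := h
        rcases List.mem_cons.1 hℓ' with rfl | hmem
        · exact absurd hz' hℓ
        · exact ⟨ℓ', hmem, hz'⟩
      split_ifs
      · rw [assignSum_eq_zero_of_mem e hz L h', mul_zero]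
      · rfl

end Template

/-! ### Moments, enumerations and the factorisation at the decoupled point -/

section Moments

variable {ι : Type*} [DecidableEq ι] {F : Type*} [Fintype F] [LinearOrder F] {R : Type*} [CommRing R]
variable (c : F → ι) (G : Matrix F F R)

/-- The field pairs attached to the clusters of `Q`. [folklore] -/
def fieldsOf (Q : Finset ι) : Finset F := Finset.univ.filter fun a => c a ∈ Q

omit [LinearOrder F] in
/-- Membership in `fieldsOf`. [folklore] -/
@[simp] theorem mem_fieldsOf {Q : Finset ι} {a : F} : a ∈ fieldsOf c Q ↔ c a ∈ Q := by
  simp [fieldsOf]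

/-- The increasing enumeration of the field pairs of the clusters of `Q`. [folklore] -/
def enum (Q : Finset ι) : Fin (fieldsOf c Q).card ↪o F := (fieldsOf c Q).orderEmbOfFin rfl

/-- The enumeration enumerates fields of `Q`. [folklore] -/
theorem c_enum_mem (Q : Finset ι) (i : Fin (fieldsOf c Q).card) : c (enum c Q i) ∈ Q :=
  (mem_fieldsOf c).1 ((fieldsOf c Q).orderEmbOfFin_mem rfl i)

/-- The **moment** (simple expectation) of the clusters in `Q`: the determinant of the propagator
matrix restricted to their field pairs, increasingly enumerated — the Wick-rule value `det G` of
`𝓔(∏_{x∈Q} ψ̃(P_x))` for balanced monomials in paired normal form, up to the global orientation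
sign (Mastropietro 2008, (2.79)). [cite: Mastropietro2008, §2.8 (2.79)] -/
def moment (Q : Finset ι) : R := (G.submatrix (enum c Q) (enum c Q)).det

/-- The empty moment is `1`. [folklore] -/
theorem moment_empty : moment c G ∅ = 1 := by
  have h : (fieldsOf c (∅ : Finset ι)).card = 0 := by simp [fieldsOf]
  haveI : IsEmpty (Fin (fieldsOf c (∅ : Finset ι)).card) := ⟨fun i => absurd i.isLt (by omega)⟩
  exact det_isEmpty

/-- Summing a function of fields vanishing outside the clusters of `Q` over the enumeration of a
superset `W ⊇ Q` = summing it over the enumeration of `Q`. [folklore] -/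
theorem sum_enum_eq_sum_enum {M : Type*} [AddCommMonoid M] {Q W : Finset ι} (hQW : Q ⊆ W)
    (h : F → M) (h0 : ∀ a, c a ∉ Q → h a = 0) :
    ∑ i, h (enum c W i) = ∑ i, h (enum c Q i) := by
  have key : ∀ V : Finset ι, ∑ i, h (enum c V i) = ∑ a ∈ fieldsOf c V, h a := by
    intro V
    rw [← Finset.sum_coe_sort (fieldsOf c V), ← ((fieldsOf c V).orderIsoOfFin rfl).toEquiv.sum_comp]
    rfl
  rw [key, key]
  refine (Finset.sum_subset (fun a ha => ?_) (fun a _ ha => h0 a ?_)).symm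
  · exact (mem_fieldsOf c).2 (hQW ((mem_fieldsOf c).1 ha))
  · exact fun h' => ha ((mem_fieldsOf c).2 h')

omit [LinearOrder F] in
/-- The fields of `Q` and of `W ∖ Q` are disjoint. [folklore] -/
theorem disjoint_fieldsOf_sdiff (Q W : Finset ι) : Disjoint (fieldsOf c Q) (fieldsOf c (W \ Q)) := by
  rw [Finset.disjoint_left]
  intro a ha hb
  rw [mem_fieldsOf] at ha hb
  exact (Finset.mem_sdiff.1 hb).2 ha

/-- The fields of `W ⊇ Q` are those of `Q` and those of `W ∖ Q`. [folklore] -/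
theorem mem_fieldsOf_union_iff {Q W : Finset ι} (hQW : Q ⊆ W) (a : F) :
    a ∈ fieldsOf c Q ∪ fieldsOf c (W \ Q) ↔ a ∈ fieldsOf c W := by
  rw [Finset.mem_union, mem_fieldsOf, mem_fieldsOf, mem_fieldsOf, Finset.mem_sdiff]
  constructor
  · rintro (h | ⟨h, -⟩); exacts [hQW h, h]
  · intro h; by_cases hq : c a ∈ Q; exacts [Or.inl hq, Or.inr ⟨h, hq⟩]

/-- The reindexing `Φ : Fin |F_Q| ⊕ Fin |F_{W∖Q}| ≃ Fin |F_W|` under which the enumeration of the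
fields of `W` restricts to the enumerations of the fields of `Q ⊆ W` and of `W ∖ Q`. [folklore] -/
def splitEquiv {Q W : Finset ι} (hQW : Q ⊆ W) :
    Fin (fieldsOf c Q).card ⊕ Fin (fieldsOf c (W \ Q)).card ≃ Fin (fieldsOf c W).card :=
  (Equiv.sumCongr ((fieldsOf c Q).orderIsoOfFin rfl).toEquiv
      ((fieldsOf c (W \ Q)).orderIsoOfFin rfl).toEquiv).trans <|
    (Equiv.Finset.union _ _ (disjoint_fieldsOf_sdiff c Q W)).trans <|
      (Equiv.subtypeEquivRight (mem_fieldsOf_union_iff c hQW)).trans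
        ((fieldsOf c W).orderIsoOfFin rfl).symm.toEquiv

/-- `enum W ∘ Φ ∘ inl = enum Q`. [folklore] -/
theorem enum_splitEquiv_inl {Q W : Finset ι} (hQW : Q ⊆ W) (x : Fin (fieldsOf c Q).card) :
    enum c W (splitEquiv c hQW (Sum.inl x)) = enum c Q x := by
  unfold enum splitEquiv
  rw [← Finset.coe_orderIsoOfFin_apply, ← Finset.coe_orderIsoOfFin_apply]
  simp

/-- `enum W ∘ Φ ∘ inr = enum (W ∖ Q)`. [folklore] -/
theorem enum_splitEquiv_inr {Q W : Finset ι} (hQW : Q ⊆ W) (x : Fin (fieldsOf c (W \ Q)).card) :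
    enum c W (splitEquiv c hQW (Sum.inr x)) = enum c (W \ Q) x := by
  unfold enum splitEquiv
  rw [← Finset.coe_orderIsoOfFin_apply, ← Finset.coe_orderIsoOfFin_apply]
  simp

variable {v : ι} {k : ℕ}

/-- **Factorisation at the decoupled point.**  Let `s` be a valid script with point set `Q ⊆ W`
and let the replaced rows `I` come from field lines inside `Q`.  At the decoupled interpolation
point `σ_s` the pair variables crossing `∂Q` vanish and those outside `Q` are `1`, so the
interpolated `W`-matrix is block diagonal: `det_W(σ_s) = det_Q(σ_s) · moment (W ∖ Q)`
(Mastropietro 2008, (2.90)/(2.99): the decoupled factor `e^{-V(X∖X_r)}`). [folklore] -/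
theorem det_map_aeval_tmpl_eq (s : Script v k) {W : Finset ι}
    (hQW : Finset.univ.image s.y ⊆ W) (I : Finset F) (jm : F → F)
    (hI : ∀ a ∈ I, c a ∈ Finset.univ.image s.y ∧ c (jm a) ∈ Finset.univ.image s.y) :
    aeval (s.decPt R) (tmpl c G (enum c W) I jm).det =
      aeval (s.decPt R) (tmpl c G (enum c (Finset.univ.image s.y)) I jm).det *
        C (moment c G (W \ Finset.univ.image s.y)) := by
  set Q := Finset.univ.image s.y with hQ
  rw [AlgHom.map_det, AlgHom.map_det]
  set N := (aeval (s.decPt R)).mapMatrix (tmpl c G (enum c W) I jm) with hN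
  have hA : N.submatrix (splitEquiv c hQW ∘ Sum.inl) (splitEquiv c hQW ∘ Sum.inl) =
      (aeval (s.decPt R)).mapMatrix (tmpl c G (enum c Q) I jm) := by
    refine Matrix.ext fun x y => ?_
    simp only [hN, AlgHom.mapMatrix_apply, map_apply, submatrix_apply, Function.comp_apply, tmpl,
      enum_splitEquiv_inl]
  have hB : N.submatrix (splitEquiv c hQW ∘ Sum.inr) (splitEquiv c hQW ∘ Sum.inr) =
      (G.submatrix (enum c (W \ Q)) (enum c (W \ Q))).map C := by
    refine Matrix.ext fun x y => ?_
    have hx := c_enum_mem c (W \ Q) x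
    have hy := c_enum_mem c (W \ Q) y
    rw [Finset.mem_sdiff] at hx hy
    have hxI : enum c (W \ Q) x ∉ I := fun h => hx.2 (hI _ h).1
    simp only [hN, AlgHom.mapMatrix_apply, map_apply, submatrix_apply, Function.comp_apply, tmpl,
      enum_splitEquiv_inr, hxI, if_false, map_mul, aeval_X, aeval_C, MvPolynomial.algebraMap_eq,
      Script.decPt_mk_of_notMem R s hx.2 hy.2, one_mul]
  have h12 : ∀ x y, N (splitEquiv c hQW (Sum.inl x)) (splitEquiv c hQW (Sum.inr y)) = 0 := by
    intro x y
    have hx := c_enum_mem c Q x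
    have hy := c_enum_mem c (W \ Q) y
    rw [Finset.mem_sdiff] at hy
    simp only [hN, AlgHom.mapMatrix_apply, map_apply, tmpl, enum_splitEquiv_inl, enum_splitEquiv_inr]
    split_ifs with h1 h2
    · exact absurd (hI _ h1).2 (h2 ▸ hy.2)
    · exact map_zero _
    · rw [map_mul, aeval_X, Script.decPt_mk_of_mem_of_notMem R s hx hy.2, zero_mul]
  have h21 : ∀ x y, N (splitEquiv c hQW (Sum.inr x)) (splitEquiv c hQW (Sum.inl y)) = 0 := by
    intro x y
    have hx := c_enum_mem c (W \ Q) x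
    have hy := c_enum_mem c Q y
    rw [Finset.mem_sdiff] at hx
    have hxI : enum c (W \ Q) x ∉ I := fun h => hx.2 (hI _ h).1
    simp only [hN, AlgHom.mapMatrix_apply, map_apply, tmpl, enum_splitEquiv_inl, enum_splitEquiv_inr,
      hxI, if_false]
    rw [map_mul, aeval_X, Sym2.eq_swap, Script.decPt_mk_of_mem_of_notMem R s hy hx.2, zero_mul]
  rw [det_eq_mul_of_blocks N (splitEquiv c hQW) h12 h21, hA, hB, moment, RingHom.map_det,
    RingHom.mapMatrix_apply]

/-- **Factorisation of the assignment sums**: along lines inside the point set `Q ⊆ W` of the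
script, `aeval σ_s (assignSum_W L) = aeval σ_s (assignSum_Q L) · moment (W ∖ Q)`. [folklore] -/
theorem aeval_assignSum_eq (s : Script v k) {W : Finset ι} (hQW : Finset.univ.image s.y ⊆ W) :
    ∀ (L : List (Sym2 ι)) (_ : ∀ ℓ ∈ L, ∀ a ∈ ℓ, a ∈ Finset.univ.image s.y) (I : Finset F) (jm : F → F)
      (_ : ∀ a ∈ I, c a ∈ Finset.univ.image s.y ∧ c (jm a) ∈ Finset.univ.image s.y),
      aeval (s.decPt R) (assignSum c G (enum c W) L I jm) =
        aeval (s.decPt R) (assignSum c G (enum c (Finset.univ.image s.y)) L I jm) *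
          C (moment c G (W \ Finset.univ.image s.y))
  | [], _, I, jm, hI => det_map_aeval_tmpl_eq c G s hQW I jm hI
  | ℓ :: L, hL, I, jm, hI => by
    set Q := Finset.univ.image s.y with hQ
    have hℓ : ∀ a ∈ ℓ, a ∈ Q := hL ℓ (List.mem_cons_self ..)
    have hL' : ∀ ℓ' ∈ L, ∀ a ∈ ℓ', a ∈ Q := fun ℓ' h => hL ℓ' (List.mem_cons_of_mem _ h)
    -- the summand as a function of the field line `(a, b)`
    set Φ : F → F → MvPolynomial ι R := fun a b =>
      if a ∉ I ∧ s(c a, c b) = ℓ then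
        C (G a b) * (aeval (s.decPt R) (assignSum c G (enum c Q) L (insert a I) (Function.update jm a b)) *
          C (moment c G (W \ Q)))
      else 0 with hΦ
    have hΦa : ∀ a, c a ∉ Q → ∀ b, Φ a b = 0 := fun a ha b => by
      rw [hΦ]; dsimp only
      rw [if_neg]
      rintro ⟨-, h⟩
      exact ha (hℓ _ (h ▸ Sym2.mem_mk_left _ _))
    have hΦb : ∀ a b, c b ∉ Q → Φ a b = 0 := fun a b hb => by
      rw [hΦ]; dsimp only
      rw [if_neg]
      rintro ⟨-, h⟩
      exact hb (hℓ _ (h ▸ Sym2.mem_mk_right _ _))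
    have hstep : ∀ (i j : Fin (fieldsOf c W).card),
        aeval (s.decPt R) (if enum c W i ∉ I ∧ s(c (enum c W i), c (enum c W j)) = ℓ then
          C (G (enum c W i) (enum c W j)) *
            assignSum c G (enum c W) L (insert (enum c W i) I) (Function.update jm (enum c W i) (enum c W j))
          else 0) = Φ (enum c W i) (enum c W j) := by
      intro i j
      rw [hΦ]; dsimp only
      split_ifs with h
      · have ha : c (enum c W i) ∈ Q := hℓ _ (h.2 ▸ Sym2.mem_mk_left _ _)
        have hb : c (enum c W j) ∈ Q := hℓ _ (h.2 ▸ Sym2.mem_mk_right _ _)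
        rw [map_mul, aeval_C, MvPolynomial.algebraMap_eq,
          aeval_assignSum_eq s hQW L hL' _ _ (fun a ha' => ?_)]
        rcases Finset.mem_insert.1 ha' with rfl | ha'
        · rw [Function.update_self]; exact ⟨ha, hb⟩
        · have hne : a ≠ enum c W i := fun h' => h.1 (h' ▸ ha')
          rw [Function.update_of_ne hne]; exact hI a ha'
      · exact map_zero _
    have hstepQ : ∀ (i j : Fin (fieldsOf c Q).card),
        aeval (s.decPt R) (if enum c Q i ∉ I ∧ s(c (enum c Q i), c (enum c Q j)) = ℓ then
          C (G (enum c Q i) (enum c Q j)) *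
            assignSum c G (enum c Q) L (insert (enum c Q i) I) (Function.update jm (enum c Q i) (enum c Q j))
          else 0) * C (moment c G (W \ Q)) = Φ (enum c Q i) (enum c Q j) := by
      intro i j
      rw [hΦ]; dsimp only
      split_ifs with h
      · rw [map_mul, aeval_C, MvPolynomial.algebraMap_eq]; exact mul_assoc _ _ _
      · rw [map_zero]; exact zero_mul _
    rw [assignSum, assignSum]
    simp_rw [map_sum, Finset.sum_mul, hstep, hstepQ]
    have hout := sum_enum_eq_sum_enum c hQW (fun a => ∑ j, Φ a (enum c W j)) (fun a ha =>
      Finset.sum_eq_zero fun j _ => hΦa a ha _)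
    rw [hout]
    refine Finset.sum_congr rfl fun i _ => ?_
    have hin := sum_enum_eq_sum_enum c hQW (fun b => Φ (enum c Q i) b) (fun b hb => hΦb _ b hb)
    exact hin

end Moments

/-! ### The tree expansion of the truncated expectation -/

section TreeExpansion

variable {ι : Type*} [Fintype ι] [DecidableEq ι] {F : Type*} [Fintype F] [LinearOrder F]
  {R : Type*} [CommRing R] [Algebra ℚ R]
variable (c : F → ι) (G : Matrix F F R)

/-- The contribution of one valid script `s` (rooted at `v`, point set `Q`): the sum over the
field-line assignments along its lines of `∏ G_ℓ · ∫_{[0,1]^ι} w_s(t) det G^T(σ_s(t)) dt`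
(Mastropietro 2008, (2.101), one anchored tree with one compatible sequence `X₂, …, X_r`).
[folklore] -/
def scriptTerm (v : ι) {k : ℕ} (s : Script v k) : R :=
  cubeIntegral ι R (s.weight R *
    aeval (s.decPt R) (assignSum c G (enum c (Finset.univ.image s.y)) s.lines ∅ id))

/-- **The tree sum** `K_v(Q)`: the sum of `scriptTerm` over all valid scripts rooted at `v` whose
point set is exactly `Q` (Mastropietro 2008, (2.93)/(2.101): `K(X_r)`). [folklore] -/
def treeSum (v : ι) (Q : Finset ι) : R :=
  ∑ k ∈ Finset.range (Fintype.card ι), ∑ s : Script v k,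
    if s.Valid ∧ Finset.univ.image s.y = Q then scriptTerm c G v s else 0

/-- The term of a script in the peeling expansion of `moment W`: zero unless its point set `Q`
lies inside `W`, and then `scriptTerm s · moment (W ∖ Q)`. [folklore] -/
theorem term_det_tmpl_eq (W : Finset ι) {v : ι} (hv : v ∈ W) {k : ℕ} (s : Script v k) :
    Script.term R (tmpl c G (enum c W) ∅ id).det s =
      if Finset.univ.image s.y ⊆ W then scriptTerm c G v s * moment c G (W \ Finset.univ.image s.y)
      else 0 := by
  rw [Script.term, Script.lineDeriv_eq, listDeriv_det_tmpl c G (enum c W).injective]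
  split_ifs with hQW
  · have hI : ∀ a ∈ (∅ : Finset F), c a ∈ Finset.univ.image s.y ∧ c (id a) ∈ Finset.univ.image s.y :=
      fun a ha => absurd ha (Finset.notMem_empty a)
    rw [aeval_assignSum_eq c G s hQW s.lines (Script.mem_image_of_mem_lines s) ∅ id hI, scriptTerm,
      ← mul_assoc, mul_comm _ (C _), ← smul_eq_C_mul, map_smul, smul_eq_mul, mul_comm]
  · obtain ⟨z, hzQ, hzW⟩ := Finset.not_subset.1 hQW
    obtain ⟨m, -, rfl⟩ := Finset.mem_image.1 hzQ
    have hm : m ≠ 0 := fun h => hzW (by rw [h, Script.y_zero]; exact hv)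
    rw [assignSum_eq_zero_of_mem c G (enum c W) (z := s.y m) (fun i h => hzW (h ▸ c_enum_mem c W i))
      s.lines (Script.exists_mem_lines s m hm), map_zero, mul_zero, map_zero]

/-- **The peeling recursion for the moments** (Mastropietro 2008, (2.91)/(2.99):
`e^{-V(X)} = Σ_r K(X_r) e^{-V(X∖X_r)}`): for every `v ∈ W`,
`moment W = Σ_{v ∈ Q ⊆ W} K_v(Q) · moment (W ∖ Q)`. [cite: Mastropietro2008, §2.8 (2.91)-(2.99)] -/
theorem moment_eq_sum_treeSum (W : Finset ι) {v : ι} (hv : v ∈ W) :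
    moment c G W = ∑ Q ∈ W.powerset.filter (fun Q => v ∈ Q), treeSum c G v Q * moment c G (W \ Q) := by
  set T := W.powerset.filter (fun Q => v ∈ Q) with hT
  have hmem : ∀ {k : ℕ} (s : Script v k), Finset.univ.image s.y ∈ T ↔ Finset.univ.image s.y ⊆ W := by
    intro k s
    rw [hT, Finset.mem_filter, Finset.mem_powerset, and_iff_left_iff_imp]
    exact fun _ => Finset.mem_image.2 ⟨0, Finset.mem_univ _, s.y_zero⟩
  have h1 : ∀ (k : ℕ) (s : Script v k), (if s.Valid then Script.term R (tmpl c G (enum c W) ∅ id).det s else 0) =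
      ∑ Q ∈ T, if s.Valid ∧ Finset.univ.image s.y = Q then scriptTerm c G v s * moment c G (W \ Q) else 0 := by
    intro k s
    by_cases hs : s.Valid
    · simp only [hs, if_true, true_and]
      rw [term_det_tmpl_eq c G W hv s, Finset.sum_ite_eq, if_congr (hmem s) rfl rfl]
    · simp only [hs, if_false, false_and]
      exact (Finset.sum_const_zero).symm
  have hm : moment c G W = eval (fun _ => (1 : R)) (tmpl c G (enum c W) ∅ id).det :=
    (eval_one_det_tmpl c G _ _).symm
  rw [hm, Script.eval_one_eq_sum_term (root := v)]
  calc ∑ k ∈ Finset.range (Fintype.card ι), ∑ s : Script v k,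
        (if s.Valid then Script.term R (tmpl c G (enum c W) ∅ id).det s else 0)
      = ∑ k ∈ Finset.range (Fintype.card ι), ∑ s : Script v k, ∑ Q ∈ T,
          (if s.Valid ∧ Finset.univ.image s.y = Q then scriptTerm c G v s * moment c G (W \ Q) else 0) :=
        Finset.sum_congr rfl fun k _ => Finset.sum_congr rfl fun s _ => h1 k s
    _ = ∑ Q ∈ T, ∑ k ∈ Finset.range (Fintype.card ι), ∑ s : Script v k,
          (if s.Valid ∧ Finset.univ.image s.y = Q then scriptTerm c G v s * moment c G (W \ Q) else 0) := by
        rw [Finset.sum_comm]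
        exact Finset.sum_congr rfl fun k _ => Finset.sum_comm
    _ = ∑ Q ∈ T, treeSum c G v Q * moment c G (W \ Q) := by
        refine Finset.sum_congr rfl fun Q _ => ?_
        rw [treeSum, Finset.sum_mul]
        refine Finset.sum_congr rfl fun k _ => ?_
        rw [Finset.sum_mul]
        refine Finset.sum_congr rfl fun s _ => ?_
        rw [ite_mul, zero_mul]

/-- **Uniqueness for the block recursion**: a family `K_v(W)` (`v ∈ W`) satisfying the block form
of the cluster decomposition, `m(W) = Σ_{v ∈ Q ⊆ W} K_v(Q) m(W ∖ Q)` with `m ∅ = 1`, is the Ursell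
function (compare `sum_ursellOf_mul_eq`). [folklore] -/
theorem eq_ursellOf_of_block_recursion {α : Type*} [DecidableEq α] {C : Type*} [CommRing C]
    (m : Finset α → C) (hm0 : m ∅ = 1) (K : α → Finset α → C)
    (hK : ∀ (W : Finset α) (v : α), v ∈ W →
      ∑ Q ∈ W.powerset.filter (fun Q => v ∈ Q), K v Q * m (W \ Q) = m W) :
    ∀ (W : Finset α) (v : α), v ∈ W → K v W = ursellOf m W := by
  intro W
  induction W using Finset.strongInduction with
  | H W ih =>
    intro v hv
    have h1 := hK W v hv
    have h2 := sum_ursellOf_mul_eq m hm0 hv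
    have hW : W ∈ W.powerset.filter (fun Q => v ∈ Q) := by simp [hv]
    rw [← Finset.add_sum_erase _ _ hW, Finset.sdiff_self, hm0, mul_one] at h1 h2
    have h3 : ∑ Q ∈ (W.powerset.filter (fun Q => v ∈ Q)).erase W, K v Q * m (W \ Q) =
        ∑ Q ∈ (W.powerset.filter (fun Q => v ∈ Q)).erase W, ursellOf m Q * m (W \ Q) := by
      refine Finset.sum_congr rfl fun Q hQ => ?_
      obtain ⟨hne, hQ'⟩ := Finset.mem_erase.1 hQ
      obtain ⟨hQW, hvQ⟩ := Finset.mem_filter.1 hQ'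
      rw [ih Q (Finset.ssubset_iff_subset_ne.2 ⟨Finset.mem_powerset.1 hQW, hne⟩) v hvQ]
    linear_combination h1 - h2 - h3

/-- **The tree expansion of the truncated fermionic expectation** (Battle–Brydges–Federbush /
Gawedzki–Kupiainen–Lesniewski; Mastropietro 2008, (2.101)/(2.118); Benfatto–Giuliani–Mastropietro
2006, (2.66)): the truncated expectation `𝓔ᵀ` of the balanced monomials of the clusters in `W`,
i.e. the Ursell function of the moments `Q ↦ det G_Q`, equals, for every choice of root `v ∈ W`,
the tree sum `K_v(W)` — the sum over the valid scripts rooted at `v` spanning `W` and over the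
anchored field-line assignments along their lines of
`∏_{ℓ} G_ℓ · ∫_{[0,1]^ι} w_s(t) det G^T(σ_s(t)) dt`, where `G^T(t)` is the propagator matrix of the
remaining fields with entries scaled by the interpolation factors `t_{x x'}` of their clusters
(and the rows of the tree lines replaced by unit rows). [cite: Mastropietro2008, §2.9 (2.118)] -/
theorem ursellOf_moment_eq_treeSum (W : Finset ι) {v : ι} (hv : v ∈ W) :
    ursellOf (moment c G) W = treeSum c G v W :=
  (eq_ursellOf_of_block_recursion (moment c G) (moment_empty c G) (treeSum c G)
    (fun W _ hv => (moment_eq_sum_treeSum c G W hv).symm) W v hv).symm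

end TreeExpansion

end FermionicTree

end Literature.MathematicalPhysics.QuantumLattice
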